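import Summits.BirchSwinnertonDyer.BirchSwinnertonDyer.Theorems.KimAtThreeDeepUpperStubCounting
import HarnessLib

/-!
# Route `KimAtThreeKolyvagin` (rung W2), crux `DeepUpperAtThree`: the LIFTABILITY GLUE for the STUB
# port — from Mazur–Rubin Thm. 4.4.3 for a deep generator to the stub of the shallow generator

Cell `bsd-addord`, seat `bsd-addord-w2-c3` (D-0074 row B6), item `stmt-BirchSwinnertonDyer-19076`.
TOOL theorems (abelian groups; Kolyvagin systems of an arbitrary finite discrete `Γ_K`-module); no
definition, no named fact, no `sorry`; nothing asserted about any curve.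

WHY.  `KimAtThreeDeepUpperStubLiftable.StubLift.nsmul_apply_mem_stub_of_liftable` (Mazur–Rubin
Thm. 4.4.3) gives, for a Kolyvagin system `g̃` of a module `T̃` of length `m` and `2K ≤ m + 1`, the
stub shape of `p^{m−K} g̃_∅` inside `H¹_{𝓕̃}(K, T̃)[p^K]`.  The STUB port `hStub` of crux 19076 is
about the generator `g` of `KS(T, 𝓕)` for the SHALLOW module `T = T̃/p^K` (think `T = E[3^K]`,
`T̃ = E[3^m]`).  This file is the module-free glue between the two (Mazur–Rubin's "sufficiently
liftable", Def. 4.4.2 / Thm. 4.4.3, and Cor. 4.5.2 (iii): evaluation at a core vertex is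
injective), in four lemmas whose every arithmetic input is a hypothesis:
* `eq_zsmul_of_apply_eq_zsmul_of_injective` — two Kolyvagin systems `g`, `r` of the same
  `(T, 𝓕, 𝒫)` with `g_n = z • r_n` at a vertex `n` where evaluation is injective on `KS` agree up to
  `z` at EVERY level (so `g_∅ = z • r_∅`); here `r = red_* g̃` restricted to the deep primes;
* `map_eq_of_card` — ONTO-ness of the reduction `red_* : H¹_{𝓕̃(n)}(T̃) → H¹_{𝓕(n)}(T)` at a core
  vertex by counting (`#H̃(n) = p^m`, `#H̃(n)[p^{m−K}] ≤ p^{m−K}`, `#H(n) = p^K`,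
  `ker red_* ≤ ker p^{m−K}`), whence `H(n) = ℤ · red_*(g̃_n)` when `H̃(n) = ℤ · g̃_n`
  (`eq_zmultiples_map_of_eq_zmultiples`);
* `exists_eq_nsmul_of_map_eq_nsmul` — Lemma 4.1.1 (i) read backwards: if `ι_*` is injective with
  `ι_*(H) = H̃ ∩ ker p^K` and `ι_*(r) = N • ẽ` with `ẽ ∈ H̃[p^K]`, then `r = N • e` with `e ∈ H`;
* `card_eq_of_map_eq_inf` — the count transfer `#H = #(H̃ ∩ ker p^K)` along such an `ι_*`
  (so the consumer's `3^{n₀}`, defined by `#H = 3^K · 3^{n₀}`, is the `#X̃(∅)[3^K]` of Thm. 4.4.3).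
[cite: MazurRubin2004, Def. 4.4.2, Thm. 4.4.3 (pp. 46–47); Lemma 4.1.1 (i) (p. 35); Cor. 4.5.2 (iii) (p. 48)]
[cite: Sakamoto2024, Thm. 4.4 (1) (p. 926)]
-/

set_option autoImplicit false
-- the Theorems namespace of a single-conjunct summit repeats the summit name by design (D-0017)
set_option linter.dupNamespace false

noncomputable section

open scoped Classical NumberField ContRepresentation
open Function NumberField IsDedekindDomain
  Literature.NumberTheory.GaloisRepresentations
  Literature.NumberTheory.GaloisRepresentations.DiscreteGaloisModule Literature.NumberTheory.GaloisCohomology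
  Summit.BirchSwinnertonDyer.Rank1Residual.GaloisImage
  Summit.BirchSwinnertonDyer.BirchSwinnertonDyer.Theorems.KimAtThreeDeepUpperStubCounting.StubLift

universe u

namespace Summit.BirchSwinnertonDyer.BirchSwinnertonDyer.Theorems.KimAtThreeDeepUpperStubGlue

namespace StubLift

/-! ### §1 Two Kolyvagin systems agreeing at a vertex where evaluation is injective -/

section KS

variable {K : Type u} [Field K] [NumberField K]
variable {M : Type u} [AddCommGroup M] [TopologicalSpace M] [DiscreteTopology M]
variable {ρ : DiscreteGaloisModule K M}

/-- **Rigidity at a vertex.**  If evaluation at the level `n` is injective on `KS(T, 𝓕, 𝒫)` (i.e.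
`κ_n = 0 ⟹ κ ≡ 0`; Mazur–Rubin Cor. 4.5.2 (iii) / Sakamoto Thm. 4.4 (1) at a core vertex — a
HYPOTHESIS here) and two Kolyvagin systems satisfy `g_n = z • r_n`, then `g_d = z • r_d` at every
level `d`. [cite: MazurRubin2004, Cor. 4.5.2 (iii) (p. 48)] [cite: Sakamoto2024, Thm. 4.4 (1) (p. 926)] -/
theorem eq_zsmul_of_apply_eq_zsmul_of_injective {D : KolyvaginDatum ρ} {𝓕 : SelmerStructure ρ}
    {n : Finset (HeightOneSpectrum (𝓞 K))}
    (hinj : ∀ κ : Finset (HeightOneSpectrum (𝓞 K)) → galoisCohomology ρ 1,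
      D.IsKolyvaginSystem 𝓕 κ → κ n = 0 → ∀ d, κ d = 0)
    {g r : Finset (HeightOneSpectrum (𝓞 K)) → galoisCohomology ρ 1}
    (hg : D.IsKolyvaginSystem 𝓕 g) (hr : D.IsKolyvaginSystem 𝓕 r) {z : ℤ} (hn : g n = z • r n)
    (d : Finset (HeightOneSpectrum (𝓞 K))) : g d = z • r d := by
  have hmem : g - z • r ∈ D.kolyvaginSystems 𝓕 :=
    sub_mem ((KolyvaginDatum.mem_kolyvaginSystems_iff _ _ _).2 hg)
      (AddSubgroup.zsmul_mem _ ((KolyvaginDatum.mem_kolyvaginSystems_iff _ _ _).2 hr) z)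
  have h0 : (g - z • r) n = 0 := by
    change g n - z • r n = 0
    rw [hn, sub_self]
  have h := hinj _ ((KolyvaginDatum.mem_kolyvaginSystems_iff _ _ _).1 hmem) h0 d
  change g d - z • r d = 0 at h
  exact sub_eq_zero.mp h

/-- The `ℕ`-scalar form used by the STUB port (`∃ a : ℕ, g_∅ = a • r_∅`): from `g_n ∈ ℤ · r_n` and
injectivity at `n`, for a module killed by `N` (so that `ℤ`-multiples are `ℕ`-multiples).
[cite: MazurRubin2004, Cor. 4.5.2 (iii) (p. 48)] -/
theorem exists_apply_eq_nsmul_of_mem_zmultiples {D : KolyvaginDatum ρ} {𝓕 : SelmerStructure ρ}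
    {n : Finset (HeightOneSpectrum (𝓞 K))}
    (hinj : ∀ κ : Finset (HeightOneSpectrum (𝓞 K)) → galoisCohomology ρ 1,
      D.IsKolyvaginSystem 𝓕 κ → κ n = 0 → ∀ d, κ d = 0)
    {N : ℕ} (hN : 0 < N) (hV : ∀ c : galoisCohomology ρ 1, N • c = 0)
    {g r : Finset (HeightOneSpectrum (𝓞 K)) → galoisCohomology ρ 1}
    (hg : D.IsKolyvaginSystem 𝓕 g) (hr : D.IsKolyvaginSystem 𝓕 r)
    (hn : g n ∈ AddSubgroup.zmultiples (r n)) (d : Finset (HeightOneSpectrum (𝓞 K))) :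
    ∃ a : ℕ, g d = a • r d := by
  obtain ⟨z, hz⟩ := AddSubgroup.mem_zmultiples_iff.mp hn
  have h := eq_zsmul_of_apply_eq_zsmul_of_injective hinj hg hr hz.symm d
  -- `z • x = (z mod N) • x` since `N • x = 0`
  refine ⟨(z % N).toNat, ?_⟩
  have hmod : (((z % N).toNat : ℕ) : ℤ) = z % N :=
    Int.toNat_of_nonneg (Int.emod_nonneg _ (by exact_mod_cast hN.ne'))
  rw [h, ← natCast_zsmul, hmod]
  have hdecomp : z = z % N + (N : ℤ) * (z / N) := by
    have h' := Int.emod_add_ediv_mul z N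
    rw [mul_comm] at h'
    exact h'.symm
  conv_lhs => rw [hdecomp]
  rw [add_zsmul, mul_zsmul, natCast_zsmul, hV, add_zero]

end KS

/-! ### §2 Onto-ness of the reduction at a core vertex, by counting -/

section Onto

variable {V W : Type*} [AddCommGroup V] [AddCommGroup W]

/-- **Onto by counting.**  Let `f : V → W` be additive, `G ≤ V` finite with `#G = p^m`,
`f(G) ≤ H` with `#H = p^K`, and suppose the elements of `G` killed by `f` are killed by `p^{m−K}`,
while `#G[p^{m−K}] ≤ p^{m−K}`.  Then `f(G) = H`.  (At a core vertex `n` of a module of length `m`: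
`G = H¹_{𝓕̃(n)}(T̃) ≅ ℤ/p^m`, `H = H¹_{𝓕(n)}(T̃/p^K) ≅ ℤ/p^K`, `f = red_*` with
`ι_* ∘ red_* = p^{m−K}`.) [cite: MazurRubin2004, Lemma 4.1.1 (i) and Cor. 4.5.2 (v) (pp. 35, 48)] -/
theorem map_eq_of_card {p : ℕ} [hp : Fact p.Prime] (f : V →+ W) (G : AddSubgroup V) [Finite G]
    (H : AddSubgroup W) {m K : ℕ} (hKm : K ≤ m) (hG : Nat.card G = p ^ m)
    (hH : Nat.card H = p ^ K) (hle : G.map f ≤ H)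
    (hker : ∀ x ∈ G, f x = 0 → p ^ (m - K) • x = 0)
    (htor : Nat.card ↥(G ⊓ (nsmulAddMonoidHom (p ^ (m - K))).ker) ≤ p ^ (m - K)) :
    G.map f = H := by
  haveI : Finite ↥(G ⊓ f.ker) := finite_inf_left _ _
  haveI : Finite ↥(G ⊓ (nsmulAddMonoidHom (p ^ (m - K))).ker) := finite_inf_left _ _
  haveI : Finite H := Nat.finite_of_card_ne_zero (by rw [hH]; exact (pow_pos hp.out.pos _).ne')
  have hc := card_eq_card_inf_ker_mul_card_map f G
  -- `G ⊓ ker f ≤ G[p^{m-K}]`, so `#(G ⊓ ker f) ≤ p^{m-K}`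
  have hkle : G ⊓ f.ker ≤ G ⊓ (nsmulAddMonoidHom (p ^ (m - K))).ker := fun x hx =>
    AddSubgroup.mem_inf.2 ⟨(AddSubgroup.mem_inf.1 hx).1, by
      rw [AddMonoidHom.mem_ker, nsmulAddMonoidHom_apply]
      exact hker x (AddSubgroup.mem_inf.1 hx).1 (AddSubgroup.mem_inf.1 hx).2⟩
  have hkcard : Nat.card ↥(G ⊓ f.ker) ≤ p ^ (m - K) :=
    (AddSubgroup.card_le_of_le hkle).trans htor
  -- hence `#f(G) ≥ p^K = #H`
  refine AddSubgroup.eq_of_le_of_card_ge hle ?_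
  rw [hH]
  by_contra hlt
  push Not at hlt
  have h1 : Nat.card ↥(G ⊓ f.ker) * Nat.card ↥(G.map f) < p ^ (m - K) * p ^ K :=
    calc Nat.card ↥(G ⊓ f.ker) * Nat.card ↥(G.map f)
        ≤ p ^ (m - K) * Nat.card ↥(G.map f) := Nat.mul_le_mul_right _ hkcard
      _ < p ^ (m - K) * p ^ K := Nat.mul_lt_mul_of_pos_left hlt (pow_pos hp.out.pos _)
  rw [← hc, hG, ← pow_add, Nat.sub_add_cancel hKm] at h1
  exact lt_irrefl _ h1

/-- From a cyclic source to a cyclic target: if `G = ℤ · x` and `f(G) = H` then `H = ℤ · f x`.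
[folklore] -/
theorem eq_zmultiples_map_of_eq_zmultiples (f : V →+ W) {G : AddSubgroup V} {H : AddSubgroup W}
    {x : V} (hG : G = AddSubgroup.zmultiples x) (hf : G.map f = H) :
    H = AddSubgroup.zmultiples (f x) := by
  rw [← hf, hG, AddMonoidHom.map_zmultiples]

end Onto

/-! ### §3 Back along `ι_*`: Lemma 4.1.1 (i) read backwards, and the count transfer -/

section Incl

variable {V W : Type*} [AddCommGroup V] [AddCommGroup W]

/-- **Descending the stub along `ι_*`.**  If `ι_*` is injective and maps `H = H¹_𝓕(K, T)` onto
`H̃ ∩ ker p^k` (`H̃ = H¹_{𝓕̃}(K, T̃)`; Mazur–Rubin Lemma 4.1.1 (i)), and `ι_*(r) = N • ẽ` with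
`ẽ ∈ H̃` killed by `p^K`, then `r = N • e` for some `e ∈ H`. [cite: MazurRubin2004, Lemma 4.1.1 (i) (p. 35)] -/
theorem exists_eq_nsmul_of_map_eq_nsmul {p k : ℕ} (ι : V →+ W) (hι : Function.Injective ι)
    (H : AddSubgroup V) (H' : AddSubgroup W)
    (hF1 : H.map ι = H' ⊓ (nsmulAddMonoidHom (p ^ k)).ker)
    {r : V} {N : ℕ} {e' : W} (he' : e' ∈ H') (he'K : p ^ k • e' = 0) (hr : ι r = N • e') :
    ∃ e ∈ H, r = N • e := by
  have hmem : e' ∈ H.map ι := by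
    rw [hF1]
    exact AddSubgroup.mem_inf.2 ⟨he', by rw [AddMonoidHom.mem_ker, nsmulAddMonoidHom_apply]; exact he'K⟩
  obtain ⟨e, he, rfl⟩ := AddSubgroup.mem_map.1 hmem
  refine ⟨e, he, hι ?_⟩
  rw [hr, map_nsmul]

/-- **The count transfer along `ι_*`**: `#H = #(H̃ ∩ ker p^K)`. [cite: MazurRubin2004, Lemma 4.1.1 (i) (p. 35)] -/
theorem card_eq_of_map_eq_inf {p k : ℕ} (ι : V →+ W) (hι : Function.Injective ι)
    (H : AddSubgroup V) (H' : AddSubgroup W)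
    (hF1 : H.map ι = H' ⊓ (nsmulAddMonoidHom (p ^ k)).ker) :
    Nat.card H = Nat.card ↥(H' ⊓ (nsmulAddMonoidHom (p ^ k)).ker) := by
  rw [← hF1]
  exact Nat.card_congr (H.equivMapOfInjective ι hι).toEquiv

/-- **The consumer's exponent.**  If `#H = p^k · p^{n₀}` (the Poitou–Tate count of the shallow
module, core rank one) and `#(H̃ ∩ ker p^K) = p^k · N` (the count (A1) of Thm. 4.4.3 at depth `K`),
then `N = p^{n₀}`. [cite: MazurRubin2004, Thm. 4.1.13 (p. 38)] -/
theorem eq_pow_of_counts {p k n₀ N : ℕ} [hp : Fact p.Prime] (ι : V →+ W) (hι : Function.Injective ι)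
    (H : AddSubgroup V) (H' : AddSubgroup W)
    (hF1 : H.map ι = H' ⊓ (nsmulAddMonoidHom (p ^ k)).ker)
    (hH : Nat.card H = p ^ k * p ^ n₀)
    (hH' : Nat.card ↥(H' ⊓ (nsmulAddMonoidHom (p ^ k)).ker) = p ^ k * N) : N = p ^ n₀ := by
  have h := card_eq_of_map_eq_inf ι hι H H' hF1
  rw [hH, hH'] at h
  exact (Nat.eq_of_mul_eq_mul_left (pow_pos hp.out.pos _) h).symm

end Incl

/-! ### §4 The glue, assembled: the STUB of the shallow generator from Thm. 4.4.3 for a lift -/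

section Assembled

variable {K : Type u} [Field K] [NumberField K]
variable {M : Type u} [AddCommGroup M] [TopologicalSpace M] [DiscreteTopology M]
variable {M' : Type u} [AddCommGroup M'] [TopologicalSpace M'] [DiscreteTopology M']
variable {ρ : DiscreteGaloisModule K M} {ρ' : DiscreteGaloisModule K M'}

/-- **The STUB at `∅` of a sufficiently liftable generator — module-free assembly.**  Data: the
shallow module `T` (`ρ`, think `E[3^K]`) with `p^K · H¹(K,T) = 0`, its Selmer structure `𝓕` and a
Kolyvagin datum `D′` (the deep primes); the deep module `T̃` (`ρ′`) with `H̃ = H¹_{𝓕̃}(K, T̃)`; the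
maps `ι_* : H¹(K,T) → H¹(K,T̃)` (injective, `ι_*(H¹_𝓕) = H̃ ∩ ker p^K` — Lemma 4.1.1 (i)) and a
system `r` of `(T, 𝓕, D′)` (the reduction `red_* g̃` of the deep generator) with the STUB SHAPE
`ι_*(r_∅) = N • ẽ`, `ẽ ∈ H̃[p^k]` (Thm. 4.4.3 at `(K, ∅)` for `g̃`, `N = #X̃(∅)[p^K]`, transported by
`ι_* ∘ red_* = p^{m−K}`); a system `g` of `(T, 𝓕, D′)` (the shallow generator restricted to the deep
primes) with `g_n ∈ ℤ · r_n` at a vertex `n` where evaluation is injective on `KS(T, 𝓕, D′)`; and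
the counts `#H¹_𝓕 = p^k · p^{n₀}`, `#(H̃ ∩ ker p^K) = p^k · N`.  THEN `g_∅ = p^{n₀} • e` with
`e ∈ H¹_𝓕(K, T)` — the binder `hStub` of `KimAtThreeDeepUpperOfPorts.deepUpper_conclusion_of_ports`
in its strong form (no `+ Sel`). [cite: MazurRubin2004, Thm. 4.4.3 (p. 46), Lemma 4.1.1 (i), Cor. 4.5.2 (iii)] -/
theorem apply_empty_eq_pow_nsmul_of_liftable {p k n₀ N : ℕ} [hp : Fact p.Prime]
    (hV : ∀ c : galoisCohomology ρ 1, p ^ k • c = 0)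
    {𝓕 : SelmerStructure ρ} {D' : KolyvaginDatum ρ} {n : Finset (HeightOneSpectrum (𝓞 K))}
    (hinj : ∀ κ : Finset (HeightOneSpectrum (𝓞 K)) → galoisCohomology ρ 1,
      D'.IsKolyvaginSystem 𝓕 κ → κ n = 0 → ∀ d, κ d = 0)
    (ι : galoisCohomology ρ 1 →+ galoisCohomology ρ' 1) (hι : Function.Injective ι)
    (H' : AddSubgroup (galoisCohomology ρ' 1))
    (hF1 : 𝓕.selmerGroup.map ι = H' ⊓ (nsmulAddMonoidHom (p ^ k)).ker)
    (hH : Nat.card 𝓕.selmerGroup = p ^ k * p ^ n₀)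
    (hH' : Nat.card ↥(H' ⊓ (nsmulAddMonoidHom (p ^ k)).ker) = p ^ k * N)
    {g r : Finset (HeightOneSpectrum (𝓞 K)) → galoisCohomology ρ 1}
    (hg : D'.IsKolyvaginSystem 𝓕 g) (hr : D'.IsKolyvaginSystem 𝓕 r)
    (hn : g n ∈ AddSubgroup.zmultiples (r n))
    {e' : galoisCohomology ρ' 1} (he' : e' ∈ H') (he'K : p ^ k • e' = 0) (hre' : ι (r ∅) = N • e') :
    ∃ e ∈ 𝓕.selmerGroup, g ∅ = p ^ n₀ • e := by
  have hN : N = p ^ n₀ := eq_pow_of_counts ι hι 𝓕.selmerGroup H' hF1 hH hH'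
  obtain ⟨e, he, hre⟩ := exists_eq_nsmul_of_map_eq_nsmul ι hι 𝓕.selmerGroup H' hF1 he' he'K hre'
  obtain ⟨a, ha⟩ := exists_apply_eq_nsmul_of_mem_zmultiples hinj (pow_pos hp.out.pos k) hV hg hr hn ∅
  refine ⟨a • e, AddSubgroup.nsmul_mem _ he _, ?_⟩
  rw [ha, hre, hN, ← mul_nsmul', mul_comm, mul_nsmul']

end Assembled

end StubLift

end Summit.BirchSwinnertonDyer.BirchSwinnertonDyer.Theorems.KimAtThreeDeepUpperStubGlue

end
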